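import Mathlib
import Summits.Ventures.PercRepro2.Defs
import Summits.Ventures.PercRepro2.CoinTraceBlock
import Summits.Ventures.PercRepro2.CoinTraceShift
import Summits.Ventures.PercRepro2.CoinTwoStarAbstract
import Summits.Ventures.PercRepro2.CoinTraceBlocks

/-!
# The abstract pendant lemma for the PATHSTAR trace family in the sign-provable regime (blind
cell PercRepro2, night-2 g3; proofs/NIGHT2-DARC.md §19)

`P = {w, v₁, v₂, v₃}` with the pathstar structure `w → v₁ → v₂ → t, w → v₃ → t`: the traces
carrying mass satisfy `v₁ ∈ Z → v₂ ∈ Z` and `w ∈ Z → (v₁ ∈ Z ∧ v₂ ∈ Z) ∨ v₃ ∈ Z`, so the pivotal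
family is `{wv₁v₂, wv₃, wv₂v₃, P}`.  Under the SUBADDITIVITY `ρ_{wv₂v₃} ≤ ρ_{wv₁v₂} + ρ_{wv₃}`
the pivotal weight is a nonnegative combination of the indicators of the six «good» families
`𝒩_w`, `𝒩_w ∪ {P}`, `𝒩_w ∪ {Z ∋ vᵢ}` (`i = 1, 2, 3`), `𝒵` (`pathStar_rho_decomp`), whose blocks
are all nonnegative (`CoinTraceBlocks.lean`); hence `S′ ≥ 0` (`pathStar_functional_nonneg`).
Outside that regime the up-set `{wv₂v₃, P}` of NIGHT2-DARC.md §15.9 is needed.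
-/

namespace Summit.Ventures.PercRepro2.Coin

section PathStar

open Classical

variable {V : Type*} [DecidableEq V] {R : Type*} [Field R] [LinearOrder R] [IsStrictOrderedRing R]

omit [LinearOrder R] [IsStrictOrderedRing R] in
/-- The pointwise Abel decomposition of the pivotal weight on the pathstar family, with the free
coefficient `c₅`. -/
lemma pathStar_rho_decomp {w v₁ v₂ v₃ : V} (hwv₁ : w ≠ v₁) (hwv₂ : w ≠ v₂) (hwv₃ : w ≠ v₃)
    (hv₁₂ : v₁ ≠ v₂) (hv₁₃ : v₁ ≠ v₃) (hv₂₃ : v₂ ≠ v₃) (μ ρ : Finset V → R) (c₅ : R)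
    (hμ0a : ∀ Z ∈ ({w, v₁, v₂, v₃} : Finset V).powerset, v₁ ∈ Z → v₂ ∉ Z → μ Z = 0)
    (hμ0b : ∀ Z ∈ ({w, v₁, v₂, v₃} : Finset V).powerset, w ∈ Z → ¬ (v₁ ∈ Z ∧ v₂ ∈ Z) → v₃ ∉ Z → μ Z = 0)
    (hρ1 : ∀ Z ∈ ({w, v₁, v₂, v₃} : Finset V).powerset, w ∉ Z → ρ Z = 1) {Z : Finset V} (hZ : Z ∈ ({w, v₁, v₂, v₃} : Finset V).powerset) :
    μ Z * ρ Z = μ Z * ((1 - ρ ({w, v₁, v₂, v₃} : Finset V)) * (if Disjoint Z {w} then (1 : R) else 0)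
      + (ρ ({w, v₁, v₂, v₃} : Finset V) - ρ {w, v₁, v₂} - ρ {w, v₃} + c₅) * (if Disjoint Z {w} ∨ Z = ({w, v₁, v₂, v₃} : Finset V) then (1 : R) else 0)
      + (ρ {w, v₁, v₂} - ρ {w, v₂, v₃} + ρ {w, v₃} - c₅) *
          (if Disjoint Z {w} ∨ v₁ ∈ Z then (1 : R) else 0)
      + (ρ {w, v₂, v₃} - ρ {w, v₃}) * (if Disjoint Z {w} ∨ v₂ ∈ Z then (1 : R) else 0)
      + (ρ {w, v₃} - c₅) * (if Disjoint Z {w} ∨ v₃ ∈ Z then (1 : R) else 0) + c₅) := by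
  have hZP : Z ⊆ ({w, v₁, v₂, v₃} : Finset V) := Finset.mem_powerset.mp hZ
  by_cases hw : w ∈ Z
  · have hd : ¬ Disjoint Z {w} := fun h => Finset.disjoint_singleton_right.mp h hw
    by_cases hv₁ : v₁ ∈ Z <;> by_cases hv₂ : v₂ ∈ Z <;> by_cases hv₃ : v₃ ∈ Z
    · -- `Z = P`
      have hZe : Z = ({w, v₁, v₂, v₃} : Finset V) := by
        ext z
        constructor
        · exact fun h => hZP h
        · intro h
          simp only [Finset.mem_insert, Finset.mem_singleton] at h
          rcases h with rfl | rfl | rfl | rfl <;> assumption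
      rw [if_neg hd, if_pos (Or.inr hZe), if_pos (Or.inr hv₁), if_pos (Or.inr hv₂),
        if_pos (Or.inr hv₃), hZe]
      ring
    · -- `Z = {w, v₁, v₂}`
      have hZe : Z = {w, v₁, v₂} := by
        ext z
        constructor
        · intro h
          have := hZP h
          simp only [Finset.mem_insert, Finset.mem_singleton] at this ⊢
          rcases this with rfl | rfl | rfl | rfl
          · exact Or.inl rfl
          · exact Or.inr (Or.inl rfl)
          · exact Or.inr (Or.inr rfl)
          · exact absurd h hv₃
        · intro h
          simp only [Finset.mem_insert, Finset.mem_singleton] at h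
          rcases h with rfl | rfl | rfl <;> assumption
      have hZP' : Z ≠ ({w, v₁, v₂, v₃} : Finset V) := by
        intro h; exact hv₃ (h ▸ (by simp))
      simp only [hd, hv₁, hv₂, hv₃, hZP', or_true, if_true, or_false, if_false]
      rw [hZe]
      ring
    · -- `v₁ ∈ Z`, `v₂ ∉ Z`: zero mass
      rw [hμ0a Z hZ hv₁ hv₂]
      ring
    · rw [hμ0a Z hZ hv₁ hv₂]
      ring
    · -- `Z = {w, v₂, v₃}`
      have hZe : Z = {w, v₂, v₃} := by
        ext z
        constructor
        · intro h
          have := hZP h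
          simp only [Finset.mem_insert, Finset.mem_singleton] at this ⊢
          rcases this with rfl | rfl | rfl | rfl
          · exact Or.inl rfl
          · exact absurd h hv₁
          · exact Or.inr (Or.inl rfl)
          · exact Or.inr (Or.inr rfl)
        · intro h
          simp only [Finset.mem_insert, Finset.mem_singleton] at h
          rcases h with rfl | rfl | rfl <;> assumption
      have hZP' : Z ≠ ({w, v₁, v₂, v₃} : Finset V) := by
        intro h; exact hv₁ (h ▸ (by simp))
      simp only [hd, hv₁, hv₂, hv₃, hZP', or_true, if_true, or_false, if_false]
      rw [hZe]
      ring
    · -- `v₂ ∈ Z`, `v₁, v₃ ∉ Z`: zero mass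
      rw [hμ0b Z hZ hw (fun h => hv₁ h.1) hv₃]
      ring
    · -- `Z = {w, v₃}`
      have hZe : Z = {w, v₃} := by
        ext z
        constructor
        · intro h
          have := hZP h
          simp only [Finset.mem_insert, Finset.mem_singleton] at this ⊢
          rcases this with rfl | rfl | rfl | rfl
          · exact Or.inl rfl
          · exact absurd h hv₁
          · exact absurd h hv₂
          · exact Or.inr rfl
        · intro h
          simp only [Finset.mem_insert, Finset.mem_singleton] at h
          rcases h with rfl | rfl <;> assumption
      have hZP' : Z ≠ ({w, v₁, v₂, v₃} : Finset V) := by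
        intro h; exact hv₁ (h ▸ (by simp))
      simp only [hd, hv₁, hv₂, hv₃, hZP', or_true, if_true, or_false, if_false]
      rw [hZe]
      ring
    · -- `Z = {w}`: zero mass
      rw [hμ0b Z hZ hw (fun h => hv₁ h.1) hv₃]
      ring
  · have hd : Disjoint Z {w} := Finset.disjoint_singleton_right.mpr hw
    rw [hρ1 Z hZ hw]
    simp only [hd, true_or, if_true]
    ring

/-- **The abstract pendant lemma for the pathstar family in the sign-provable regime.** -/
theorem pathStar_functional_nonneg {w v₁ v₂ v₃ : V} (hwv₁ : w ≠ v₁) (hwv₂ : w ≠ v₂)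
    (hwv₃ : w ≠ v₃) (hv₁₂ : v₁ ≠ v₂) (hv₁₃ : v₁ ≠ v₃) (hv₂₃ : v₂ ≠ v₃)
    (μ x y xh yh ρ : Finset V → R) (c₅ : R)
    (hμ : ∀ Z ∈ ({w, v₁, v₂, v₃} : Finset V).powerset, 0 ≤ μ Z)
    (hμ0a : ∀ Z ∈ ({w, v₁, v₂, v₃} : Finset V).powerset, v₁ ∈ Z → v₂ ∉ Z → μ Z = 0)
    (hμ0b : ∀ Z ∈ ({w, v₁, v₂, v₃} : Finset V).powerset, w ∈ Z → ¬ (v₁ ∈ Z ∧ v₂ ∈ Z) → v₃ ∉ Z → μ Z = 0)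
    (hx1 : ∀ Z : Finset V, Z ⊆ ({w, v₁, v₂, v₃} : Finset V) → x Z ≤ 1) (hy1 : ∀ Z : Finset V, Z ⊆ ({w, v₁, v₂, v₃} : Finset V) → y Z ≤ 1)
    (hxh1 : ∀ Z : Finset V, Z ⊆ ({w, v₁, v₂, v₃} : Finset V) → xh Z ≤ 1) (hyh1 : ∀ Z : Finset V, Z ⊆ ({w, v₁, v₂, v₃} : Finset V) → yh Z ≤ 1)
    (hxanti : ∀ Z Z' : Finset V, Z ⊆ Z' → Z' ⊆ ({w, v₁, v₂, v₃} : Finset V) → x Z' ≤ x Z)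
    (hyanti : ∀ Z Z' : Finset V, Z ⊆ Z' → Z' ⊆ ({w, v₁, v₂, v₃} : Finset V) → y Z' ≤ y Z)
    (hxhanti : ∀ Z Z' : Finset V, Z ⊆ Z' → Z' ⊆ ({w, v₁, v₂, v₃} : Finset V) → xh Z' ≤ xh Z)
    (hyhanti : ∀ Z Z' : Finset V, Z ⊆ Z' → Z' ⊆ ({w, v₁, v₂, v₃} : Finset V) → yh Z' ≤ yh Z)
    (hxh_le : ∀ Z : Finset V, Z ⊆ ({w, v₁, v₂, v₃} : Finset V) → xh Z ≤ x Z) (hyh_le : ∀ Z : Finset V, Z ⊆ ({w, v₁, v₂, v₃} : Finset V) → yh Z ≤ y Z)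
    (hxh_eq : ∀ Z : Finset V, Z ⊆ ({w, v₁, v₂, v₃} : Finset V) → w ∉ Z → xh Z = x Z)
    (hyh_eq : ∀ Z : Finset V, Z ⊆ ({w, v₁, v₂, v₃} : Finset V) → w ∉ Z → yh Z = y Z)
    (hρ1 : ∀ Z ∈ ({w, v₁, v₂, v₃} : Finset V).powerset, w ∉ Z → ρ Z = 1) (hρle : ρ ({w, v₁, v₂, v₃} : Finset V) ≤ 1)
    (hc₅0 : 0 ≤ c₅) (hc₅₁ : ρ {w, v₁, v₂} + ρ {w, v₃} - ρ ({w, v₁, v₂, v₃} : Finset V) ≤ c₅) (hc₅₂ : c₅ ≤ ρ {w, v₃})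
    (hc₅₃ : c₅ ≤ ρ {w, v₁, v₂} - ρ {w, v₂, v₃} + ρ {w, v₃}) (hρ₃₂₃ : ρ {w, v₃} ≤ ρ {w, v₂, v₃})
    (hPA : TracePA ({w, v₁, v₂, v₃} : Finset V) μ) (hCU₁ : TraceCUPA ({w, v₁, v₂, v₃} : Finset V) μ v₁) (hCU₂ : TraceCUPA ({w, v₁, v₂, v₃} : Finset V) μ v₂)
    (hCU₃ : TraceCUPA ({w, v₁, v₂, v₃} : Finset V) μ v₃) :
    0 ≤ ∑ Z ∈ ({w, v₁, v₂, v₃} : Finset V).powerset, μ Z * ρ Z *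
      (xh Z * (∑ Z' ∈ ({w, v₁, v₂, v₃} : Finset V).powerset, μ Z') - ∑ Z' ∈ ({w, v₁, v₂, v₃} : Finset V).powerset, x Z' * μ Z') *
      (yh Z * (∑ Z' ∈ ({w, v₁, v₂, v₃} : Finset V).powerset, μ Z') - ∑ Z' ∈ ({w, v₁, v₂, v₃} : Finset V).powerset, y Z' * μ Z') := by
  have hwP : w ∈ ({w, v₁, v₂, v₃} : Finset V) := by simp
  have hv₁P : v₁ ∈ ({w, v₁, v₂, v₃} : Finset V) := by simp
  have hv₂P : v₂ ∈ ({w, v₁, v₂, v₃} : Finset V) := by simp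
  have hv₃P : v₃ ∈ ({w, v₁, v₂, v₃} : Finset V) := by simp
  obtain ⟨Λ, hΛ⟩ : ∃ L : R, L = ∑ Z ∈ ({w, v₁, v₂, v₃} : Finset V).powerset, μ Z := ⟨_, rfl⟩
  obtain ⟨MX, hMX⟩ : ∃ M : R, M = ∑ Z ∈ ({w, v₁, v₂, v₃} : Finset V).powerset, x Z * μ Z := ⟨_, rfl⟩
  obtain ⟨MY, hMY⟩ : ∃ M : R, M = ∑ Z ∈ ({w, v₁, v₂, v₃} : Finset V).powerset, y Z * μ Z := ⟨_, rfl⟩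
  have hA := avoid_block_nonneg ({w, v₁, v₂, v₃} : Finset V) hwP μ x y xh yh hμ hx1 hy1 hxh1 hyh1 hxanti hyanti hxhanti
    hyhanti hxh_eq hyh_eq hPA
  have hT := top_block_nonneg ({w, v₁, v₂, v₃} : Finset V) hwP μ x y xh yh hμ hx1 hy1 hxh1 hyh1 hxanti hyanti hxhanti
    hyhanti hxh_le hyh_le hxh_eq hyh_eq hPA
  have hC₁ := cylinder_block_nonneg ({w, v₁, v₂, v₃} : Finset V) hwP hv₁P μ x y xh yh hμ hx1 hy1 hxh1 hyh1 hxanti hyanti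
    hxhanti hyhanti hxh_le hyh_le hxh_eq hyh_eq hPA hCU₁
  have hC₂ := cylinder_block_nonneg ({w, v₁, v₂, v₃} : Finset V) hwP hv₂P μ x y xh yh hμ hx1 hy1 hxh1 hyh1 hxanti hyanti
    hxhanti hyhanti hxh_le hyh_le hxh_eq hyh_eq hPA hCU₂
  have hC₃ := cylinder_block_nonneg ({w, v₁, v₂, v₃} : Finset V) hwP hv₃P μ x y xh yh hμ hx1 hy1 hxh1 hyh1 hxanti hyanti
    hxhanti hyhanti hxh_le hyh_le hxh_eq hyh_eq hPA hCU₃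
  have hD := all_block_nonneg ({w, v₁, v₂, v₃} : Finset V) μ x y xh yh hμ hxh1 hyh1 hxhanti hyhanti hxh_le hyh_le hPA
  rw [← hΛ, ← hMX, ← hMY] at hA hT hC₁ hC₂ hC₃ hD ⊢
  -- ABEL
  have hdec : ∑ Z ∈ ({w, v₁, v₂, v₃} : Finset V).powerset, μ Z * ρ Z * (xh Z * Λ - MX) * (yh Z * Λ - MY) =
      (1 - ρ ({w, v₁, v₂, v₃} : Finset V)) * ∑ Z ∈ ({w, v₁, v₂, v₃} : Finset V).powerset.filter (fun Z => Disjoint Z {w}),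
          μ Z * (xh Z * Λ - MX) * (yh Z * Λ - MY)
      + (ρ ({w, v₁, v₂, v₃} : Finset V) - ρ {w, v₁, v₂} - ρ {w, v₃} + c₅) *
          ∑ Z ∈ ({w, v₁, v₂, v₃} : Finset V).powerset.filter (fun Z => Disjoint Z {w} ∨ Z = ({w, v₁, v₂, v₃} : Finset V)),
            μ Z * (xh Z * Λ - MX) * (yh Z * Λ - MY)
      + (ρ {w, v₁, v₂} - ρ {w, v₂, v₃} + ρ {w, v₃} - c₅) *
          ∑ Z ∈ ({w, v₁, v₂, v₃} : Finset V).powerset.filter (fun Z => Disjoint Z {w} ∨ v₁ ∈ Z),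
            μ Z * (xh Z * Λ - MX) * (yh Z * Λ - MY)
      + (ρ {w, v₂, v₃} - ρ {w, v₃}) *
          ∑ Z ∈ ({w, v₁, v₂, v₃} : Finset V).powerset.filter (fun Z => Disjoint Z {w} ∨ v₂ ∈ Z),
            μ Z * (xh Z * Λ - MX) * (yh Z * Λ - MY)
      + (ρ {w, v₃} - c₅) *
          ∑ Z ∈ ({w, v₁, v₂, v₃} : Finset V).powerset.filter (fun Z => Disjoint Z {w} ∨ v₃ ∈ Z),
            μ Z * (xh Z * Λ - MX) * (yh Z * Λ - MY)
      + c₅ * ∑ Z ∈ ({w, v₁, v₂, v₃} : Finset V).powerset, μ Z * (xh Z * Λ - MX) * (yh Z * Λ - MY) := by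
    have e : ∀ Z ∈ ({w, v₁, v₂, v₃} : Finset V).powerset, μ Z * ρ Z * (xh Z * Λ - MX) * (yh Z * Λ - MY) =
        (1 - ρ ({w, v₁, v₂, v₃} : Finset V)) * ((if Disjoint Z {w} then (1 : R) else 0) *
            (μ Z * (xh Z * Λ - MX) * (yh Z * Λ - MY)))
        + (ρ ({w, v₁, v₂, v₃} : Finset V) - ρ {w, v₁, v₂} - ρ {w, v₃} + c₅) *
            ((if Disjoint Z {w} ∨ Z = ({w, v₁, v₂, v₃} : Finset V) then (1 : R) else 0) *
            (μ Z * (xh Z * Λ - MX) * (yh Z * Λ - MY)))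
        + (ρ {w, v₁, v₂} - ρ {w, v₂, v₃} + ρ {w, v₃} - c₅) *
            ((if Disjoint Z {w} ∨ v₁ ∈ Z then (1 : R) else 0) *
            (μ Z * (xh Z * Λ - MX) * (yh Z * Λ - MY)))
        + (ρ {w, v₂, v₃} - ρ {w, v₃}) * ((if Disjoint Z {w} ∨ v₂ ∈ Z then (1 : R) else 0) *
            (μ Z * (xh Z * Λ - MX) * (yh Z * Λ - MY)))
        + (ρ {w, v₃} - c₅) * ((if Disjoint Z {w} ∨ v₃ ∈ Z then (1 : R) else 0) *
            (μ Z * (xh Z * Λ - MX) * (yh Z * Λ - MY)))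
        + c₅ * (μ Z * (xh Z * Λ - MX) * (yh Z * Λ - MY)) := by
      intro Z hZ
      have hd := pathStar_rho_decomp hwv₁ hwv₂ hwv₃ hv₁₂ hv₁₃ hv₂₃ μ ρ c₅ hμ0a hμ0b hρ1 hZ
      rw [show μ Z * ρ Z * (xh Z * Λ - MX) * (yh Z * Λ - MY) =
        (μ Z * ρ Z) * ((xh Z * Λ - MX) * (yh Z * Λ - MY)) by ring, hd]
      ring
    rw [Finset.sum_congr rfl e, Finset.sum_add_distrib, Finset.sum_add_distrib,
      Finset.sum_add_distrib, Finset.sum_add_distrib, Finset.sum_add_distrib,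
      ← Finset.mul_sum, ← Finset.mul_sum, ← Finset.mul_sum, ← Finset.mul_sum, ← Finset.mul_sum,
      ← Finset.mul_sum, sum_ite_mul_eq_sum_filter, sum_ite_mul_eq_sum_filter,
      sum_ite_mul_eq_sum_filter, sum_ite_mul_eq_sum_filter, sum_ite_mul_eq_sum_filter]
  rw [hdec]
  have h0 : 0 ≤ 1 - ρ ({w, v₁, v₂, v₃} : Finset V) := by linarith
  have h1 : 0 ≤ ρ ({w, v₁, v₂, v₃} : Finset V) - ρ {w, v₁, v₂} - ρ {w, v₃} + c₅ := by linarith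
  have h2 : 0 ≤ ρ {w, v₁, v₂} - ρ {w, v₂, v₃} + ρ {w, v₃} - c₅ := by linarith
  have h3 : 0 ≤ ρ {w, v₂, v₃} - ρ {w, v₃} := by linarith
  have h4 : 0 ≤ ρ {w, v₃} - c₅ := by linarith
  exact add_nonneg (add_nonneg (add_nonneg (add_nonneg (add_nonneg (mul_nonneg h0 hA)
    (mul_nonneg h1 hT)) (mul_nonneg h2 hC₁)) (mul_nonneg h3 hC₂)) (mul_nonneg h4 hC₃))
    (mul_nonneg hc₅0 hD)

end PathStar

end Summit.Ventures.PercRepro2.Coin
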